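import Summits.ResolutionOfSingularities.ResolutionOfSingularities.Theorems.DeltaCutGradeCertificates4
import HarnessLib

/-!
# DeltaCutGradeCertificates5 — decomp-res node «GradeCut (certificates)» (lens-6 g28, critic row 210 CLEARED), tree
file 5/5 of the node

Content VERBATIM from the decomp-res lens-6 g28 certificate files
`HOME/decomp-res-lens-6/g28/GradeCutCertificates.lean` (92912ba2) + `GradeCutCertificates2.lean` (5886ffab) (ring
level, import the landed `DeltaCutRefCertificates3`; namespace `…Theorems.DeltaCutClasses`, sections
`GCertificatesA/B/C`); HOME = run/shared/lean/pub/decomp-res; critic CRITIC-LEDGER row 210 CLEARED; landing orders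
NEXT-g29.md §4 (B)/(C) + INBOX 11:01:55Z — provenance, critic text and the first lens header in full in
`DeltaCutGradeCertificates`.  `--kind proof --supports stmt-ResolutionOfSingularities-26971`.

## This file

Continuation 5/5 of `DeltaCutGradeCertificates` (same namespace / sections of the node, cut at the tree's 400-line
cap; section variables / opens replayed): scopes `GCertificatesC` — carries `G0_G2a_certificate`,
`G0_G2b_certificate`, `H_sing_axis`.

[WRITER NOTE (decomp-res writer g13): file split only (tree files ≤ 400 lines, cut at declaration boundaries; the
two lens files form one linear chain); namespace, the sections `GCertificatesA/B/C` with their `open MvPolynomial` /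
`variable {K : Type*} [Field K]`, and every declaration exactly as in the lens (the HOME-only dupNamespace-linter
lines are dropped — the library sets it; `noncomputable section`, the file-level `open` lines, `universe u` and
`open …Rescue.BedZpeBinom4Centre (mul_mem_pow_add)` are replayed in every part).]

(Sources: Hironaka1967; CossartJannsenSaito2020 Def. 3.13 / Thm. 3.14, Ch. 5–8; CossartPiltant2019 Prop. 2.6;
Giraud1975; EGAIV4 §16–§18; StacksProject 0804 / 0BIQ / 035A; Matsumura1987 §28–§31; Kollar2007 §3.)
-/

noncomputable section

open CategoryTheory CategoryTheory.Limits AlgebraicGeometry TopologicalSpace IsLocalRing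
open Literature.AlgebraicGeometry.Resolution

universe u

open Summit.ResolutionOfSingularities.ResolutionOfSingularities.Theorems.Rescue.BedZpeBinom4Centre (mul_mem_pow_add)

namespace Summit.ResolutionOfSingularities.ResolutionOfSingularities.Theorems.DeltaCutClasses

open Summit.ResolutionOfSingularities.ResolutionOfSingularities.Theorems.TwistCutClasses
open Summit.ResolutionOfSingularities.ResolutionOfSingularities.Theorems.LightCutClasses

section GCertificatesC

open MvPolynomial
variable {K : Type*} [Field K]

/-- **G₀ — THE STEP-1 CERTIFICATE (level 1 → intermediate stage; pricing (g6), EVERY chart of the blow-up of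
`L₁`)**: the three charts
(`G0_B_lineCharts`), chart `z'` EMPTY of top points (`G0_B_chart_z_noTop`); chart `u`: top `⊆ M̃′ ∪ N₁`
(`G0_Bu_top`), the two lines, their
crossing, `M̃′ ⊆ V(w″) ∩ V(z″)` (`G0_Bu_lines`); chart `w` (= P∞ literally): top `⊆ M̃ ∪ N₁` (`Pinf_top` BY NAME), the two lines
(`Pinf_mem_cube_wAxis`, `Pinf_mem_cube_sAxis`, `Pinf_axes_nondegenerate` BY NAME) — so the strict transform `M̃ ⊔
M̃′` of the old top locus is a
DISJOINT union of coordinate lines, REGULAR (R): `OldTopRegular` holds and the separating hop performs STEP 2 in the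
same hop. [new] [folklore] -/
theorem G0_G2a_certificate [CharP K 3] :
    -- (L) the three charts of the blow-up of L₁
    (aeval (linChartSubst (K := K) {0, 2, 3} 2) (X 0 ^ 3 + X 1 * X 2 ^ 2 * X 3 ^ 2 : MvPolynomial (Fin 4) K) =
        X 2 ^ 3 * (X 0 ^ 3 + X 1 * X 2 * X 3 ^ 2) ∧
      aeval (linChartSubst (K := K) {0, 2, 3} 3) (X 0 ^ 3 + X 1 * X 2 ^ 2 * X 3 ^ 2 : MvPolynomial (Fin 4) K) =
        X 3 ^ 3 * (X 0 ^ 3 + X 1 * X 2 ^ 2 * X 3) ∧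
      aeval (linChartSubst (K := K) {0, 2, 3} 0) (X 0 ^ 3 + X 1 * X 2 ^ 2 * X 3 ^ 2 : MvPolynomial (Fin 4) K) =
        X 0 ^ 3 * (1 + X 0 * X 1 * X 2 ^ 2 * X 3 ^ 2)) ∧
    -- chart z': no top point
      (∀ (𝔮 : Ideal (MvPolynomial (Fin 4) K)) [𝔮.IsPrime], ∀ s ∉ 𝔮,
        s * (1 + X 0 * X 1 * X 2 ^ 2 * X 3 ^ 2 : MvPolynomial (Fin 4) K) ∈ 𝔮 ^ 3 → False) ∧
    -- chart u: top ⊆ M̃′ ∪ N₁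
      (∀ (𝔮 : Ideal (MvPolynomial (Fin 4) K)) [𝔮.IsPrime], ∀ s ∉ 𝔮,
        s * (X 0 ^ 3 + X 1 * X 2 * X 3 ^ 2 : MvPolynomial (Fin 4) K) ∈ 𝔮 ^ 3 →
          (X 0 : MvPolynomial (Fin 4) K) ∈ 𝔮 ∧ (X 3 : MvPolynomial (Fin 4) K) ∈ 𝔮 ∧
            ((X 1 : MvPolynomial (Fin 4) K) ∈ 𝔮 ∨ (X 2 : MvPolynomial (Fin 4) K) ∈ 𝔮)) ∧
    -- chart u: the lines M̃′, N₁, their crossing, M̃′ ⊆ V(w″) ∩ V(z″)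
      ((X 0 ^ 3 + X 1 * X 2 * X 3 ^ 2 : MvPolynomial (Fin 4) K) ∈ (Ideal.span {(X 0 : MvPolynomial (Fin 4) K), X 1, X 3}) ^ 3 ∧
        (X 0 ^ 3 + X 1 * X 2 * X 3 ^ 2 : MvPolynomial (Fin 4) K) ∈ (Ideal.span {(X 0 : MvPolynomial (Fin 4) K), X 2, X 3}) ^ 3 ∧
        (X 2 : MvPolynomial (Fin 4) K) ∉ Ideal.span {(X 0 : MvPolynomial (Fin 4) K), X 1, X 3} ∧
        (X 1 : MvPolynomial (Fin 4) K) ∉ Ideal.span {(X 0 : MvPolynomial (Fin 4) K), X 2, X 3} ∧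
        Ideal.span {(X 0 : MvPolynomial (Fin 4) K), X 1, X 3} ⊔ Ideal.span {(X 0 : MvPolynomial (Fin 4) K), X 2, X 3} =
          Ideal.span {(X 0 : MvPolynomial (Fin 4) K), X 1, X 2, X 3} ∧
        ((X 3 : MvPolynomial (Fin 4) K) ∈ Ideal.span {(X 0 : MvPolynomial (Fin 4) K), X 1, X 3} ∧
          (X 0 : MvPolynomial (Fin 4) K) ∈ Ideal.span {(X 0 : MvPolynomial (Fin 4) K), X 1, X 3})) ∧
    -- chart w (= P∞): top ⊆ M̃ ∪ N₁, the two lines (landed P∞ lemmas by name)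
      ((∀ (𝔮 : Ideal (MvPolynomial (Fin 4) K)) [𝔮.IsPrime], ∀ s ∉ 𝔮,
          s * (X 0 ^ 3 + X 1 * X 2 ^ 2 * X 3 : MvPolynomial (Fin 4) K) ∈ 𝔮 ^ 3 →
            (X 0 : MvPolynomial (Fin 4) K) ∈ 𝔮 ∧ (X 2 : MvPolynomial (Fin 4) K) ∈ 𝔮 ∧
              ((X 1 : MvPolynomial (Fin 4) K) ∈ 𝔮 ∨ (X 3 : MvPolynomial (Fin 4) K) ∈ 𝔮)) ∧
        (X 0 ^ 3 + X 1 * X 2 ^ 2 * X 3 : MvPolynomial (Fin 4) K) ∈ (Ideal.span {(X 0 : MvPolynomial (Fin 4) K), X 1, X 2}) ^ 3 ∧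
        (X 0 ^ 3 + X 1 * X 2 ^ 2 * X 3 : MvPolynomial (Fin 4) K) ∈ (Ideal.span {(X 0 : MvPolynomial (Fin 4) K), X 2, X 3}) ^ 3 ∧
        ((X 1 : MvPolynomial (Fin 4) K) ∉ Ideal.span {(X 0 : MvPolynomial (Fin 4) K), X 2, X 3} ∧
          (X 3 : MvPolynomial (Fin 4) K) ∉ Ideal.span {(X 0 : MvPolynomial (Fin 4) K), X 1, X 2})) :=
  ⟨G0_B_lineCharts, fun 𝔮 _ _ hs h => G0_B_chart_z_noTop 𝔮 hs h, fun 𝔮 _ _ hs h => G0_Bu_top 𝔮 hs h, G0_Bu_lines,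
    fun 𝔮 _ _ hs h => Pinf_top 𝔮 hs h, Pinf_mem_cube_wAxis, Pinf_mem_cube_sAxis, Pinf_axes_nondegenerate⟩

/-- **G₀ — THE STEP-2 / LEVEL-2 CERTIFICATE: G₀ IS DECIDED AT g-HEIGHT 2** (pricing (g6), EVERY chart of the blow-up
of `M̃ ⊔ M̃′` and level 2).
In chart `u` (centre `M̃′`) the three charts (`G0_Cu_lineCharts`): `t`: top `= Ñ₁`, ALL TAME (`G0_Cu_chart_t_top`,
`G0_Cu_chart_t_tame`); `z″`,
`w″`: NO top point (`G0_Cu_chart_z_noTop`, `G0_Cu_chart_w_noTop`).  In chart `w` (centre `M̃`) the three charts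
(`G0_Cw_lineCharts`): `t`: top `=
Ñ₁`, ALL TAME (`G0_Cw_chart_t_top`, `G0_Cw_chart_t_tame`); `z″`, `u″`: NO top point (P∞'s `Pinf_L1_lineChart_X0_noTop`,
`Pinf_L1_lineChart_X2_noTop` BY NAME).  Over chart `z'` of step 1 and chart `z` of level 0 there is no top point at
all (`G0_B_chart_z_noTop`,
`G0_A_chart_z_noTop`).  LEVEL 2: the only top points lie on the line `Ñ₁` and are TAME — bad₂ = ∅ in EVERY chart:
`BadEmpty` with nothing
pending, `GTerminates 3 ⟨(𝔸⁴,(G₀)), none⟩` at g-height `2`. [new] [folklore] -/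
theorem G0_G2b_certificate [CharP K 3] :
    -- chart u: the three charts of the blow-up of M̃′
    (aeval (linChartSubst (K := K) {0, 1, 3} 1) (X 0 ^ 3 + X 1 * X 2 * X 3 ^ 2 : MvPolynomial (Fin 4) K) =
        X 1 ^ 3 * (X 0 ^ 3 + X 2 * X 3 ^ 2) ∧
      aeval (linChartSubst (K := K) {0, 1, 3} 0) (X 0 ^ 3 + X 1 * X 2 * X 3 ^ 2 : MvPolynomial (Fin 4) K) =
        X 0 ^ 3 * (1 + X 1 * X 2 * X 3 ^ 2) ∧
      aeval (linChartSubst (K := K) {0, 1, 3} 3) (X 0 ^ 3 + X 1 * X 2 * X 3 ^ 2 : MvPolynomial (Fin 4) K) =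
        X 3 ^ 3 * (X 0 ^ 3 + X 1 * X 2)) ∧
    -- chart u then t: top ⊆ Ñ₁ and TAME at every point of Ñ₁
      (∀ (𝔮 : Ideal (MvPolynomial (Fin 4) K)) [𝔮.IsPrime], ∀ s ∉ 𝔮,
        s * (X 0 ^ 3 + X 2 * X 3 ^ 2 : MvPolynomial (Fin 4) K) ∈ 𝔮 ^ 3 →
          (X 0 : MvPolynomial (Fin 4) K) ∈ 𝔮 ∧ (X 2 : MvPolynomial (Fin 4) K) ∈ 𝔮 ∧ (X 3 : MvPolynomial (Fin 4) K) ∈ 𝔮) ∧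
      (∀ (𝔫 : Ideal (MvPolynomial (Fin 4) K)) [𝔫.IsPrime], (X 2 : MvPolynomial (Fin 4) K) ∈ 𝔫 →
        (pderiv 3) ((pderiv 3) (X 0 ^ 3 + X 2 * X 3 ^ 2 : MvPolynomial (Fin 4) K)) = 2 * X 2 ∧
          ∀ s' ∉ 𝔫, s' * (X 2 : MvPolynomial (Fin 4) K) ∉ 𝔫 ^ 2) ∧
    -- chart u then z″ / w″: no top point
      (∀ (𝔮 : Ideal (MvPolynomial (Fin 4) K)) [𝔮.IsPrime], ∀ s ∉ 𝔮,
        s * (1 + X 1 * X 2 * X 3 ^ 2 : MvPolynomial (Fin 4) K) ∈ 𝔮 ^ 3 → False) ∧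
      (∀ (𝔮 : Ideal (MvPolynomial (Fin 4) K)) [𝔮.IsPrime], ∀ s ∉ 𝔮,
        s * (X 0 ^ 3 + X 1 * X 2 : MvPolynomial (Fin 4) K) ∈ 𝔮 ^ 3 → False) ∧
    -- chart w: the three charts of the blow-up of M̃
      (aeval (linChartSubst (K := K) {0, 1, 2} 1) (X 0 ^ 3 + X 1 * X 2 ^ 2 * X 3 : MvPolynomial (Fin 4) K) =
          X 1 ^ 3 * (X 0 ^ 3 + X 2 ^ 2 * X 3) ∧
        aeval (linChartSubst (K := K) {0, 1, 2} 0) (X 0 ^ 3 + X 1 * X 2 ^ 2 * X 3 : MvPolynomial (Fin 4) K) =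
          X 0 ^ 3 * (1 + X 1 * X 2 ^ 2 * X 3) ∧
        aeval (linChartSubst (K := K) {0, 1, 2} 2) (X 0 ^ 3 + X 1 * X 2 ^ 2 * X 3 : MvPolynomial (Fin 4) K) =
          X 2 ^ 3 * (X 0 ^ 3 + X 1 * X 3)) ∧
    -- chart w then t: top ⊆ Ñ₁ and TAME at every point of Ñ₁
      (∀ (𝔮 : Ideal (MvPolynomial (Fin 4) K)) [𝔮.IsPrime], ∀ s ∉ 𝔮,
        s * (X 0 ^ 3 + X 2 ^ 2 * X 3 : MvPolynomial (Fin 4) K) ∈ 𝔮 ^ 3 →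
          (X 0 : MvPolynomial (Fin 4) K) ∈ 𝔮 ∧ (X 2 : MvPolynomial (Fin 4) K) ∈ 𝔮 ∧ (X 3 : MvPolynomial (Fin 4) K) ∈ 𝔮) ∧
      (∀ (𝔫 : Ideal (MvPolynomial (Fin 4) K)) [𝔫.IsPrime], (X 3 : MvPolynomial (Fin 4) K) ∈ 𝔫 →
        (pderiv 2) ((pderiv 2) (X 0 ^ 3 + X 2 ^ 2 * X 3 : MvPolynomial (Fin 4) K)) = 2 * X 3 ∧
          ∀ s' ∉ 𝔫, s' * (X 3 : MvPolynomial (Fin 4) K) ∉ 𝔫 ^ 2) ∧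
    -- chart w then z″ / u″: no top point (P∞ lemmas by name)
      (∀ (𝔮 : Ideal (MvPolynomial (Fin 4) K)) [𝔮.IsPrime], ∀ s ∉ 𝔮,
        s * (1 + X 1 * X 2 ^ 2 * X 3 : MvPolynomial (Fin 4) K) ∈ 𝔮 ^ 3 → False) ∧
      (∀ (𝔮 : Ideal (MvPolynomial (Fin 4) K)) [𝔮.IsPrime], ∀ s ∉ 𝔮,
        s * (X 0 ^ 3 + X 1 * X 3 : MvPolynomial (Fin 4) K) ∈ 𝔮 ^ 3 → False) :=
  ⟨G0_Cu_lineCharts, fun 𝔮 _ _ hs h => (G0_Cu_chart_t_top 𝔮 hs h).1, fun 𝔫 _ hu => G0_Cu_chart_t_tame 𝔫 hu,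
    fun 𝔮 _ _ hs h => G0_Cu_chart_z_noTop 𝔮 hs h, fun 𝔮 _ _ hs h => G0_Cu_chart_w_noTop 𝔮 hs h,
    G0_Cw_lineCharts, fun 𝔮 _ _ hs h => (G0_Cw_chart_t_top 𝔮 hs h).1, fun 𝔫 _ hw => G0_Cw_chart_t_tame 𝔫 hw,
    fun 𝔮 _ _ hs h => Pinf_L1_lineChart_X0_noTop 𝔮 hs h, fun 𝔮 _ _ hs h => Pinf_L1_lineChart_X2_noTop 𝔮 hs h⟩

/-! #### H — the singular LINE of the Whitney umbrella `W = V(z, t²w − u²)` (pricing (g1), H's membership «with the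
same care») -/

/-- **H — `Sing(W) = W ∩ V(t) = V(z,t,u)`, THE `w`-AXIS** (correcting the pre-pricing line INBOX :1339, which wrote
`V(z,u,w)`): on `D(t)`
the surface `W` is a coordinate plane in the coordinates `(z,t,u,g)` (`H_coords`, `H_plane`: REGULAR there), and `W
∩ V(t) = V(z,t,u²) =
V(z,t,u)` set-theoretically (`u² = t²w − g ∈ (t, g)`: second conjunct); at EVERY point of this axis — closed or
generic — `g = t²w − u² ∈
(t,u)² ⊆ 𝔫²` (first conjunct), so the local ring of `W` there has embedding dimension `3 > 2`: SINGULAR.  So the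
surface part `W` of H's bad
closure is singular exactly along a LINE through the origin; in particular NOT regular (`¬ TopFrozen`, as certified
by `H_surface_singular`
at the origin), and the near-point remark of `H_plane` concerns the dense open part `W ∩ D(t)`. [new; elementary] [folklore] -/
theorem H_sing_axis :
    (X 1 ^ 2 * X 3 - X 2 ^ 2 : MvPolynomial (Fin 4) K) ∈ (Ideal.span {(X 1 : MvPolynomial (Fin 4) K), X 2}) ^ 2 ∧
      (X 2 ^ 2 : MvPolynomial (Fin 4) K) ∈ Ideal.span {(X 0 : MvPolynomial (Fin 4) K), X 1, X 1 ^ 2 * X 3 - X 2 ^ 2} := by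
  have h1 : (X 1 : MvPolynomial (Fin 4) K) ∈ Ideal.span {(X 1 : MvPolynomial (Fin 4) K), X 2} := Ideal.subset_span (by simp)
  have h2 : (X 2 : MvPolynomial (Fin 4) K) ∈ Ideal.span {(X 1 : MvPolynomial (Fin 4) K), X 2} := Ideal.subset_span (by simp)
  refine ⟨Ideal.sub_mem _ (Ideal.mul_mem_right _ _ (Ideal.pow_mem_pow h1 2)) (Ideal.pow_mem_pow h2 2), ?_⟩
  have ht : (X 1 : MvPolynomial (Fin 4) K) ∈ Ideal.span {(X 0 : MvPolynomial (Fin 4) K), X 1, X 1 ^ 2 * X 3 - X 2 ^ 2} :=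
    Ideal.subset_span (by simp)
  have hg : (X 1 ^ 2 * X 3 - X 2 ^ 2 : MvPolynomial (Fin 4) K) ∈ Ideal.span {(X 0 : MvPolynomial (Fin 4) K), X 1, X 1 ^ 2 * X 3 - X 2 ^ 2} :=
    Ideal.subset_span (by simp)
  have := Ideal.sub_mem _ (Ideal.mul_mem_left _ (X 1 * X 3) ht) hg
  rwa [show (X 1 * X 3 * X 1 - (X 1 ^ 2 * X 3 - X 2 ^ 2) : MvPolynomial (Fin 4) K) = X 2 ^ 2 by ring] at this

end GCertificatesC

end Summit.ResolutionOfSingularities.ResolutionOfSingularities.Theorems.DeltaCutClasses
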